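import Mathlib
import HarnessLib
import Summits.HubbardSuperconductivity.HubbardSuperconductivity.Theorems.KLProgrammeKLRegimeTwoVolumeTowerDataTSOfLaws
import Summits.HubbardSuperconductivity.HubbardSuperconductivity.Theorems.KLProgrammeKLRegimeTwoVolumeTowerVolumeDataTSOfReadout
import Summits.HubbardSuperconductivity.HubbardSuperconductivity.Theorems.KLProgrammeKLRegimeTwoVolumeTowerBudgetLaws

/-!
# Route `KLProgramme` — crux K3, VL child `KLRegimeVolumeLimitV17F2` (stmt-HubbardSuperconductivity-20440), skeleton «cauchy» v11: THE SOURCE-RESCALED DATA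
# PACKAGE FROM THE SUPPLIERS' READ-OUTS (assembler steps S2–S6 of ASSEMBLY-DESIGN-g15 in ONE theorem; seat hubbard-kl-k3c4-p1 g15; `--supports` 20440)

**`towerDataTS_of_readouts`** — `Nonempty (TowerDataTS β U μ t)` at fixed `(β, U, μ)` and a source scale `t ∈ (0,1]` carrying the `…TowerSrcScaleChoice` property,
from: the scale laws of the doors (`κ_j² = k₀²·8^{−j}`, `κ_j ≤ κf_j ≤ kf·κ_j`, `aW_j ≤ a₀·4^j`, caps), E1's alive budget law `S₀ j (2m) ≤ C₀·klWtBudget P Q U (j+1) (2m)`,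
FOUR scale-free inequalities on `ε_{j+1}` (`j ≤ n_β`; the `U₀/c₅` condition of the stub), and — eventually in `L`, at every admissible instance — the suppliers'
conclusions BY SHAPE: slice partition functions, p3's `ScaleCovData` (both volumes), E1's alive read-out and token #24 (both volumes), `TowerCrossData`, the (H4) rates
and the UNSCALED base bundle of the W4 chain.  Inside: `towerVolumeDataTS_of_readout` (S2) with the degree-`0` slot zeroed (`WtProfileEven.zeroDegree`),
`towerBudget_le_geom` + `towerBudgetConst_le_laws` (S3: `NV j m ≤ ε_{j+1}·32^{−j}·K·q_j^m`), `towerSmallnessIneq_of_laws_lt` (S5's two inequalities),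
`towerDataTS_of_laws` (S4–S6).  What remains for `stub_vl_towerData`: S1 (`exists_srcScale_klSrcBudget_le`, already landed) and threading the suppliers'
quantifiers `(c, U, β, L, M)` — no mathematics.

Proofs only; no definition.  Honest framing: a conditional constructor; nothing here asserts the read-outs, the stub, K3 or superconductivity.
[cite: BenfattoGiulianiMastropietro2006, §2.7-§2.9 and §3]
-/

noncomputable section

namespace Summit.HubbardSuperconductivity.HubbardSuperconductivity.Theorems.TwoVolumeSource

set_option linter.dupNamespace false -- summit = problem name (single-conjunct summit), D-0017

open Finset Filter Topology Literature.MathematicalPhysics.QuantumLattice GrassmannAlgebra Literature.Probability.LatticeModels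
  Literature.Probability.LatticeModels.BattleFederbush
open Summit.HubbardSuperconductivity.HubbardSuperconductivity.Theorems.KLRegimeSplit
open Summit.HubbardSuperconductivity.HubbardSuperconductivity.Theorems.KLProgrammeLegKernels
open Summit.HubbardSuperconductivity.HubbardSuperconductivity.Theorems.TwoPointAssembly
open Summit.HubbardSuperconductivity.HubbardSuperconductivity.Theorems.EngineV8
open Summit.HubbardSuperconductivity.HubbardSuperconductivity.Theorems.TwoVolumeDefect

set_option maxHeartbeats 1600000 in -- one large constructor application plus the budget bookkeeping
/-- **`TowerDataTS β U μ t` FROM THE SUPPLIERS' READ-OUTS** (see the module docstring). [folklore: composition; cite: BenfattoGiulianiMastropietro2006, §2.7-§2.9 and §3] -/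
theorem towerDataTS_of_readouts (β U μ : ℝ) (hβ : 0 < β) (P : SplitConsts) (Q Q' : EngConsts) (hCE : 0 ≤ Q.CE) (hCE' : 0 ≤ Q'.CE) (hKl : 0 ≤ P.Klam)
    (A : ℕ → ℕ → ℝ) (hA : ∀ j s, 0 ≤ A j s) {t : ℝ} (ht0 : 0 < t) (ht1 : t ≤ 1)
    (hτ : ∀ j, j ≤ nScales β → ∀ m : ℕ, t * klSrcBudget P Q' U A (j + 1) 1 m + t ^ 2 * klSrcBudget P Q' U A (j + 1) 2 m ≤
      klWtBudget P Q U (j + 1) 2 * (if m ≤ 2 then 1 else klWtBudget P Q' U (j + 1) m))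
    (Mth : ℕ → ℕ → ℕ) (hMth : ∀ L b M, Mth L b ≤ M → 0 < imagTimeWeight β M)
    -- constants and laws
    (Λ ΛT κ κf aW sW eW' cW cRb cCb δb : ℕ → ℝ) (sE cR cC δ : ℕ → ℕ → ℝ) (r : ℕ → ℕ) (k₀ a₀ cR₀ cC₀ kf cW₀ δb₀ r₀ C₀ εb : ℝ)
    (hΛ : ∀ j, 0 < Λ j) (hΛmono : ∀ j, Λ (j + 1) ≤ Λ j) (hΛT : ∀ j, Λ j ≤ ΛT j) (hΛr : ∀ j, j ≤ nScales β → Λ j ≤ klScale klE0 (r j))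
    (hk₀ : 0 < k₀) (hκ : ∀ j, 0 < κ j) (hκ2 : ∀ j, κ j ^ 2 = k₀ ^ 2 * ((8 : ℝ) ^ j)⁻¹) (hκfge : ∀ j, κ j ≤ κf j) (hκf : ∀ j, κf j ≤ kf * κ j)
    (hkf : 1 ≤ kf) (haW0 : ∀ j, 0 ≤ aW j) (haW : ∀ j, aW j ≤ a₀ * 4 ^ j) (hsW : ∀ j, 0 ≤ sW j) (heW' : ∀ j, 0 ≤ eW' j)
    (hcW1 : ∀ j, 1 ≤ cW j) (hcW : ∀ j, cW j ≤ cW₀) (hcRb0 : ∀ j, 0 ≤ cRb j) (hcRb : ∀ j, cRb j ≤ cR₀) (hcCb0 : ∀ j, 0 ≤ cCb j) (hcCb : ∀ j, cCb j ≤ cC₀)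
    (hδb0 : ∀ j, 0 ≤ δb j) (hδb : ∀ j, δb j ≤ δb₀) (hr₀0 : 0 ≤ r₀) (hr₀ : 8 * Real.exp 2 * (kf + 1) * (cW₀ + δb₀ + 1) ≤ r₀) (hC₀ : 0 ≤ C₀)
    -- E1's alive budgets with their law
    (S₀ : ℕ → ℕ → ℝ) (hS₀0 : ∀ j m, 0 ≤ S₀ j m) (hS₀law : ∀ j, j ≤ nScales β → ∀ m, 1 ≤ m → S₀ j (2 * m) ≤ C₀ * klWtBudget P Q U (j + 1) (2 * m))
    -- the four scale-free inequalities on `ε_{j+1}`, `j ≤ n_β`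
    (hε : ∀ j, j ≤ nScales β → 0 < epsCoupling P U (j + 1)) (hεb : ∀ j, j ≤ nScales β → epsCoupling P U (j + 1) ≤ εb)
    (hεq : ∀ j, j ≤ nScales β → 8 * Q.CE * (2 * Real.exp 2 ^ 2 * (1 + r₀) ^ 2 * k₀ ^ 2) * epsCoupling P U (j + 1) ≤ 1)
    (hεq' : ∀ j, j ≤ nScales β → 8 * Q'.CE * (2 * Real.exp 2 ^ 2 * (1 + r₀) ^ 2 * k₀ ^ 2) * epsCoupling P U (j + 1) ≤ 1)
    (hsmall : ∀ j, j < nScales β → epsCoupling P U (j + 1) *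
      (256 * Real.exp 1 ^ 2 * (a₀ + cR₀ + cC₀ + 1) * (42 * cW₀ + 4 * δb₀ + 8 * Real.exp 1) *
        (Q.CE * (2 * Real.exp 2 ^ 2 * (1 + r₀) ^ 2 * k₀ ^ 2) / 4 *
          (C₀ * (1 + 8 * Q.CE * (2 * Real.exp 2 ^ 2 * (1 + r₀) ^ 2 * k₀ ^ 2)) + 1 +
            εb * Q'.CE * (1 + 8 * Q'.CE * (2 * Real.exp 2 ^ 2 * (1 + r₀) ^ 2 * k₀ ^ 2)) / 4))) ≤ k₀ ^ 2)
    -- (H4) the mismatch rates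
    (hmis : ∀ j L, 0 ≤ sE j L ∧ 0 ≤ cR j L ∧ 0 ≤ cC j L ∧ 0 ≤ δ j L ∧ cR j L ≤ cRb j ∧ cC j L ≤ cCb j ∧ δ j L ≤ δb j)
    (hmis0 : ∀ j, Tendsto (sE j) atTop (𝓝 0) ∧ Tendsto (cR j) atTop (𝓝 0) ∧ Tendsto (cC j) atTop (𝓝 0) ∧ Tendsto (δ j) atTop (𝓝 0))
    -- (H5) the suppliers' conclusions at every admissible instance, eventually in `L`
    (hinst : ∀ᶠ L in atTop, ∀ (b M : ℕ) [NeZero L] [NeZero (b * L)] [NeZero M], Mth L b ≤ M →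
      (∀ k, k ≤ nScales β → hubbardEffPartitionFnCT L M β U μ 0 (klFlowFrameU L M β U μ (nScales β + 1)) (klScale klE0 (k + 1)) ≠ 0) ∧
      (∀ k, k ≤ nScales β → hubbardEffPartitionFnCT (b * L) M β U μ 0 (klFlowFrameU (b * L) M β U μ (nScales β + 1)) (klScale klE0 (k + 1)) ≠ 0) ∧
      (∀ j, j < nScales β → ScaleCovData (klStepCov L M β μ (klFlowFrameU L M β U μ (nScales β + 1)) j) (Λ j) (κ j) (aW j / imagTimeWeight β M) (sW j)) ∧
      (∀ j, j < nScales β →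
        ScaleCovData (klStepCov (b * L) M β μ (klFlowFrameU (b * L) M β U μ (nScales β + 1)) j) (Λ j) (κ j) (aW j / imagTimeWeight β M) (sW j)) ∧
      (∀ j, j ≤ nScales β → ∀ (m : ℕ) (q : Fin m) (w : SpaceTimeIdx L M × SectorLeg (sectorCount j)),
        klWtPinnedSumAt L M β μ (klFlowFrameU L M β U μ (nScales β + 1)) j (r j) m
          (klEffectiveAction L M β U μ (klFlowFrameU L M β U μ (nScales β + 1)) klE0 (j + 1)) q w ≤ S₀ j m) ∧
      (∀ j, j ≤ nScales β → ∀ (m : ℕ) (q : Fin m) (w : SpaceTimeIdx (b * L) M × SectorLeg (sectorCount j)),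
        klWtPinnedSumAt (b * L) M β μ (klFlowFrameU (b * L) M β U μ (nScales β + 1)) j (r j) m
          (klEffectiveAction (b * L) M β U μ (klFlowFrameU (b * L) M β U μ (nScales β + 1)) klE0 (j + 1)) q w ≤ S₀ j m) ∧
      (∀ j, j ≤ nScales β → SourceProfilesAtLev L M (klSrcBudget P Q' U A (j + 1)) β U μ (klFlowFrameU L M β U μ (nScales β + 1)) j (r j) (j + 1)) ∧
      (∀ j, j ≤ nScales β →
        SourceProfilesAtLev (b * L) M (klSrcBudget P Q' U A (j + 1)) β U μ (klFlowFrameU (b * L) M β U μ (nScales β + 1)) j (r j) (j + 1)) ∧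
      TowerCrossData L b M β μ (klFlowFrameU L M β U μ (nScales β + 1)) (klFlowFrameU (b * L) M β U μ (nScales β + 1)) (nScales β) (imagTimeWeight β M)
        Λ κ aW sW eW' ΛT cW κf (fun j => sE j L) (fun j => cR j L) (fun j => cC j L) (fun j => δ j L))
    -- the base-transfer data of `…TowerBase`
    {ΛgT cgW Λg δgb : ℝ} (hgΛT : 0 < ΛgT) (hcgW : 0 ≤ cgW) (hΛg : 0 < Λg) (NG : ℕ → ℝ) (hNG0 : ∀ k, 0 ≤ NG k)
    (δg : ℕ → ℝ) (hgδ : ∀ L, 0 ≤ δg L ∧ δg L ≤ δgb) (hgδ0 : Tendsto δg atTop (𝓝 0))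
    (hdataT : ∀ᶠ L in atTop, ∀ (b M : ℕ) [NeZero L] [NeZero (b * L)] [NeZero M], Mth L b ≤ M →
      (∀ x : SrcLabel (b * L) M 0, ∑ y, ‖klBaseTransfer (b * L) M β μ (klFlowFrameU L M β U μ (nScales β + 1)) x y‖ * (1 + ΛgT * (Torus.tnorm (x.1.1.2 - y.1.1.1.2) : ℝ)) ≤ cgW) ∧
      (∀ y : GridLeg (GridPoint (b * L) (klGridN M)) × Fin 2, ∑ x, ‖klBaseTransfer (b * L) M β μ (klFlowFrameU L M β U μ (nScales β + 1)) x y‖ * (1 + ΛgT * (Torus.tnorm (x.1.1.2 - y.1.1.1.2) : ℝ)) ≤ cgW) ∧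
      (∀ (δ' β' β₁ : Fin 2 → Fin b) (xbar : SrcLabel L M 0) (y : GridLeg (GridPoint L (klGridN M)) × Fin 2),
        ‖klBaseTransfer (b * L) M β μ (klFlowFrameU L M β U μ (nScales β + 1)) ((klBlockEquivD L b M 0).symm (β' + δ', xbar)) ((klGridBlockEquivD L b M).symm (β₁ + δ', y))‖ =
          ‖klBaseTransfer (b * L) M β μ (klFlowFrameU L M β U μ (nScales β + 1)) ((klBlockEquivD L b M 0).symm (β', xbar)) ((klGridBlockEquivD L b M).symm (β₁, y))‖) ∧
      (∀ x, ∑ y, ‖klBaseTransfer (b * L) M β μ (klFlowFrameU (b * L) M β U μ (nScales β + 1)) x y - klBaseTransfer (b * L) M β μ (klFlowFrameU L M β U μ (nScales β + 1)) x y‖ ≤ δg L) ∧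
      (∀ y, ∑ x, ‖klBaseTransfer (b * L) M β μ (klFlowFrameU (b * L) M β U μ (nScales β + 1)) x y - klBaseTransfer (b * L) M β μ (klFlowFrameU L M β U μ (nScales β + 1)) x y‖ ≤ δg L) ∧
      (∀ (k : ℕ) (p : Fin k) (y : GridLeg (GridPoint L (klGridN M))),
        ∑ Y ∈ univ.filter (fun Y : Fin k → GridLeg (GridPoint L (klGridN M)) => Y p = y),
          ‖kernel ℂ (klGridAction L M β U μ (klFlowFrameU L M β U μ (nScales β + 1))) k Y‖ *
            (1 + labelDiam (fun Y₁ Y₂ : GridLeg (GridPoint L (klGridN M)) => Λg * (Torus.tnorm (Y₁.1.1.2 - Y₂.1.1.2) : ℝ)) (univ.image Y)) ≤ imagTimeWeight β M * NG k) ∧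
      (∀ (k : ℕ) (p : Fin k) (y : GridLeg (GridPoint (b * L) (klGridN M))),
        ∑ Y ∈ univ.filter (fun Y : Fin k → GridLeg (GridPoint (b * L) (klGridN M)) => Y p = y),
          ‖kernel ℂ (klGridAction (b * L) M β U μ (klFlowFrameU (b * L) M β U μ (nScales β + 1))) k Y‖ *
            (1 + labelDiam (fun Y₁ Y₂ : GridLeg (GridPoint (b * L) (klGridN M)) => Λg * (Torus.tnorm (Y₁.1.1.2 - Y₂.1.1.2) : ℝ)) (univ.image Y)) ≤ imagTimeWeight β M * NG k))
    -- the grid data, grid scaling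
    {κE aC cb κg κg' ρS ρg' ρg₂ ρgf aw al al' mo mo' s s' Θ νW νf νg₂ νD : ℝ}
    (hκE : 0 < κE) (haC : 0 < aC) (hgκ : 0 < κg) (hgκ' : 0 < κg') (hρS : 0 < ρS) (hgρ' : 0 < ρg') (hgρ₂ : 0 < ρg₂) (hgρf : 0 < ρgf) (haw : 0 < aw)
    (haa : 0 < al' + al) (hm0 : 0 ≤ mo) (hm0' : 0 ≤ mo') (hs0 : 0 ≤ s) (hs'0 : 0 ≤ s') (hΘ0 : 0 ≤ Θ) (hνW0 : 0 ≤ νW) (hνf0 : 0 ≤ νf) (hν₂0 : 0 ≤ νg₂)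
    (hθS : Real.exp 1 * (aC + cb) * νW / κE ^ 2 < 1) (hθΘ : Real.exp 1 * aw * Θ / κg' ^ 2 < 1)
    (hθf : Real.exp 1 * (al' + al + (mo' + mo)) * νf / (κg' + κg) ^ 2 < 1) (hθ₂ : Real.exp 1 * (al' + al + (mo' + mo)) * νg₂ / (κg' + κg + (κg' + κg + (κg' + κg))) ^ 2 < 1)
    (sgE cc eE tT Te : ℕ → ℝ) (D₀ : ℕ)
    (hrate : ∀ L, 0 ≤ sgE L ∧ 0 ≤ cc L ∧ 2 * cc L ≤ cb ∧ 0 < tT L ∧ 0 ≤ Te L)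
    (hsE0 : Tendsto sgE atTop (𝓝 0)) (hcc0 : Tendsto cc atTop (𝓝 0)) (heE0 : Tendsto eE atTop (𝓝 0)) (htT0 : Tendsto tT atTop (𝓝 0))
    (hTe0 : Tendsto Te atTop (𝓝 0))
    (hgdata : ∀ᶠ L in atTop, ∀ (b M : ℕ) [NeZero L] [NeZero (b * L)] [NeZero M], Mth L b ≤ M →
      Nonempty (TowerGridDataD L b M β U μ (klFlowFrameU L M β U μ (nScales β + 1)) (klFlowFrameU (b * L) M β U μ (nScales β + 1)) (imagTimeWeight β M) κE aC κg κg' ρS ρg' ρg₂ ρgf aw al al' mo mo' s s' Θ νW νf νg₂ νD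
        (sgE L) (cc L) (eE L) (tT L) (Te L) (Nat.sqrt (L / (4 * nScales β + 7))) ((L / (4 * nScales β + 7)) - Nat.sqrt (L / (4 * nScales β + 7))) D₀))
 :
    Nonempty (TowerDataTS β U μ t) := by
  classical
  -- §0 the top scale, the constants `Dq`, `K`, the ratio `q`, the majorant constant `Aj`, the budget `NV`
  set J := nScales β with hJ
  have hE : 0 < Real.exp 2 := Real.exp_pos 2
  set Dq : ℝ := 2 * Real.exp 2 ^ 2 * (1 + r₀) ^ 2 * k₀ ^ 2 with hDq
  have hDq0 : 0 < Dq := by positivity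
  set K : ℝ := Q.CE * Dq / 4 * (C₀ * (1 + 8 * Q.CE * Dq) + 1 + εb * Q'.CE * (1 + 8 * Q'.CE * Dq) / 4) with hK
  have hεb0 : 0 ≤ εb := (hε 0 (Nat.zero_le _)).le.trans (hεb 0 (Nat.zero_le _))
  have hK0 : 0 ≤ K := by positivity
  obtain ⟨q, hq⟩ : ∃ q : ℕ → ℝ, ∀ j, q j = (8 : ℝ) ^ j / Dq := ⟨_, fun _ => rfl⟩
  have hq' : ∀ j, q j = 1 / (2 * (Real.exp 2 * (κ j + r₀ * κ j)) ^ 2) := fun j => by rw [hq, q_of_kappa_law hk₀ hr₀0 (hκ2 j)]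
  have hq0 : ∀ j, 0 < q j := fun j => by rw [hq]; positivity
  obtain ⟨Aj, hAj⟩ : ∃ Aj : ℕ → ℝ, ∀ j, Aj j = epsCoupling P U (j + 1) * ((32 : ℝ) ^ j)⁻¹ * K := ⟨_, fun _ => rfl⟩
  have hε0 : ∀ i, 0 ≤ epsCoupling P U i := fun i => epsCoupling_nonneg' hKl U i
  have hAj0 : ∀ j, 0 ≤ Aj j := fun j => by rw [hAj]; have := hε0 (j + 1); positivity
  obtain ⟨NV, hNV⟩ : ∃ NV : ℕ → ℕ → ℝ, ∀ j m, NV j m = if j ≤ J then (if m = 0 then 0 else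
      S₀ j (2 * m) + t * klSrcBudget P Q' U A (j + 1) 1 (2 * m) + t ^ 2 * klSrcBudget P Q' U A (j + 1) 2 (2 * m)) else 0 := ⟨_, fun _ _ => rfl⟩
  have hSB : ∀ j s m, 0 ≤ klSrcBudget P Q' U A j s m := fun j s m => by
    unfold klSrcBudget
    refine mul_nonneg (hA j s) ?_
    split_ifs
    · exact zero_le_one
    · exact klWtBudget_nonneg hCE' hKl U j m
  have hNV0 : ∀ j m, 0 ≤ NV j m := fun j m => by
    rw [hNV]
    split_ifs
    · exact le_rfl
    · exact add_nonneg (add_nonneg (hS₀0 j _) (mul_nonneg ht0.le (hSB _ _ _))) (mul_nonneg (sq_nonneg t) (hSB _ _ _))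
    · exact le_rfl
  -- §1 the geometric majorant `NV j m ≤ Aj j · q j ^ m`
  have hNVle : ∀ j m, NV j m ≤ Aj j * q j ^ m := by
    intro j m
    have hR : 0 ≤ Aj j * q j ^ m := mul_nonneg (hAj0 j) (pow_nonneg (hq0 j).le m)
    rw [hNV]
    by_cases hj : j ≤ J
    · rw [if_pos hj]
      rcases Nat.eq_zero_or_pos m with h0 | hm
      · rw [if_pos h0]; exact hR
      · rw [if_neg hm.ne']
        have hεj := hε j hj
        -- S₀ + t S₁ + t² S₂ ≤ S₀ + τ · (Q'-law)
        have h1 : S₀ j (2 * m) + t * klSrcBudget P Q' U A (j + 1) 1 (2 * m) + t ^ 2 * klSrcBudget P Q' U A (j + 1) 2 (2 * m) ≤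
            S₀ j (2 * m) + klWtBudget P Q U (j + 1) 2 * (if 2 * m ≤ 2 then 1 else klWtBudget P Q' U (j + 1) (2 * m)) := by
          linarith [hτ j hj (2 * m)]
        -- ≤ (geometric constant) · q^m
        have hqj : Q.CE * epsCoupling P U (j + 1) * 8 ^ (j + 1) ≤ q j := by
          rw [hq, le_div_iff₀ hDq0, pow_succ]
          have h := hεq j hj
          have h8 : (0 : ℝ) ≤ 8 ^ j := by positivity
          nlinarith [h, h8]
        have hqj' : Q'.CE * epsCoupling P U (j + 1) * 8 ^ (j + 1) ≤ q j := by
          rw [hq, le_div_iff₀ hDq0, pow_succ]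
          have h := hεq' j hj
          have h8 : (0 : ℝ) ≤ 8 ^ j := by positivity
          nlinarith [h, h8]
        have h2 := towerBudget_le_geom P Q Q' U (j + 1) hCE hCE' hεj (hq0 j) hqj hqj' hC₀ (klWtBudget_nonneg hCE hKl U (j + 1) 2) (S₀ j)
          (hS₀law j hj) hm
        -- the constant ≤ ε (32^j)⁻¹ K
        have h3 := towerBudgetConst_le_laws P Q Q' U j hCE hCE' hεj (hεb j hj) hDq0 (C₀ := C₀) (hq j) (klWtBudget_two_eq_inv_pow P Q U (j + 1))
        have h4 := mul_le_mul_of_nonneg_right h3 (pow_nonneg (hq0 j).le m)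
        rw [hAj]
        exact h1.trans (h2.trans h4)
    · rw [if_neg hj]; exact hR
  -- §2 the two smallness inequalities
  obtain ⟨hS, hS'⟩ := towerSmallnessIneq_of_laws_lt J κ aW cRb cCb cW δb Aj (fun i => epsCoupling P U i) hκ2 haW0 haW hcRb0 hcRb hcCb0 hcCb hcW1 hcW
    hδb0 hδb hK0 hε0 (fun j _ => by rw [hAj]) hsmall
  -- §3 the Gram constants decrease
  have hκmono : ∀ j, κ (j + 1) ≤ κ j := fun j => by
    have h : κ (j + 1) ^ 2 ≤ κ j ^ 2 := by
      rw [hκ2, hκ2, pow_succ (8 : ℝ) j, mul_inv]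
      have h8 : (0 : ℝ) < ((8 : ℝ) ^ j)⁻¹ := by positivity
      have hk : 0 ≤ k₀ ^ 2 * ((8 : ℝ) ^ j)⁻¹ := by positivity
      nlinarith [hk]
    exact (pow_le_pow_iff_left₀ (hκ _).le (hκ _).le two_ne_zero).1 h
  -- §4 the data bundles with the budget `NV`
  have hdata : ∀ᶠ L in atTop, ∀ (b M : ℕ) [NeZero L] [NeZero (b * L)] [NeZero M], Mth L b ≤ M →
      TowerVolumeDataTS L M β U μ (klFlowFrameU L M β U μ (nScales β + 1)) (nScales β) (imagTimeWeight β M) t Λ κ aW sW NV ∧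
      TowerVolumeDataTS (b * L) M β U μ (klFlowFrameU (b * L) M β U μ (nScales β + 1)) (nScales β) (imagTimeWeight β M) t Λ κ aW sW NV ∧
      TowerCrossData L b M β μ (klFlowFrameU L M β U μ (nScales β + 1)) (klFlowFrameU (b * L) M β U μ (nScales β + 1)) (nScales β) (imagTimeWeight β M)
        Λ κ aW sW eW' ΛT cW κf (fun j => sE j L) (fun j => cR j L) (fun j => cC j L) (fun j => δ j L) := by
    filter_upwards [hinst] with L hL
    intro b M iL ibL iM hM
    obtain ⟨hZc, hZf, hcovc, hcovf, h0c, h0f, h24c, h24f, hX⟩ := hL b M hM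
    -- the profile budget of `towerVolumeDataTS_of_readout` agrees with `NV` away from degree `0`
    have hbud : ∀ j, j ≤ J → (fun m : ℕ => if m = 0 then (0 : ℝ) else imagTimeWeight β M *
        (S₀ j (2 * m) + t * klSrcBudget P Q' U A (j + 1) 1 (2 * m) + t ^ 2 * klSrcBudget P Q' U A (j + 1) 2 (2 * m))) =
        fun m => imagTimeWeight β M * NV j m := by
      intro j hj
      funext m
      rw [hNV, if_pos hj]
      split_ifs <;> simp
    have hvol : ∀ {V : ℕ} [NeZero V],
        (∀ k, k ≤ nScales β → hubbardEffPartitionFnCT V M β U μ 0 (klFlowFrameU V M β U μ (nScales β + 1)) (klScale klE0 (k + 1)) ≠ 0) →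
        (∀ j, j < nScales β → ScaleCovData (klStepCov V M β μ (klFlowFrameU V M β U μ (nScales β + 1)) j) (Λ j) (κ j) (aW j / imagTimeWeight β M) (sW j)) →
        (∀ j, j ≤ nScales β → ∀ (m : ℕ) (q : Fin m) (w : SpaceTimeIdx V M × SectorLeg (sectorCount j)),
          klWtPinnedSumAt V M β μ (klFlowFrameU V M β U μ (nScales β + 1)) j (r j) m
            (klEffectiveAction V M β U μ (klFlowFrameU V M β U μ (nScales β + 1)) klE0 (j + 1)) q w ≤ S₀ j m) →
        (∀ j, j ≤ nScales β → SourceProfilesAtLev V M (klSrcBudget P Q' U A (j + 1)) β U μ (klFlowFrameU V M β U μ (nScales β + 1)) j (r j) (j + 1)) →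
        TowerVolumeDataTS V M β U μ (klFlowFrameU V M β U μ (nScales β + 1)) (nScales β) (imagTimeWeight β M) t Λ κ aW sW NV := by
      intro V _ hZ hcov h0 h24
      have hv := towerVolumeDataTS_of_readout hβ U μ (klFlowFrameU V M β U μ (nScales β + 1)) (nScales β) ht0.le Λ κ aW sW r hΛr hZ hcov S₀
        (fun j s m => klSrcBudget P Q' U A (j + 1) s m) hS₀0 (fun j s m => hSB (j + 1) s m) h0 h24
      exact ⟨hv.Z, hv.parity, hv.cov, fun j hj => by
        have hp := (hv.profile j hj).zeroDegree
        rw [hbud j hj] at hp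
        exact hp⟩
    exact ⟨hvol hZc hcovc h0c h24c, hvol hZf hcovf h0f h24f, hX⟩
  -- §5 the package
  exact towerDataTS_of_laws β U μ hβ ht0.le ht1 Mth hMth Λ ΛT κ κf aW sW eW' cW cRb cCb δb Aj q NV sE cR cC δ kf cW₀ δb₀ r₀ hΛ hΛmono hΛT hκ hκmono hκfge hκf
    hkf haW0 hsW heW' hcW1 hcW hcRb0 hcCb0 hδb0 hδb hr₀ hq' hNV0 hAj0 hNVle hS hS' hmis hmis0 hdata
    hgΛT hcgW hΛg NG hNG0 δg hgδ hgδ0 hdataT hκE haC hgκ hgκ' hρS hgρ' hgρ₂ hgρf haw haa hm0 hm0' hs0 hs'0 hΘ0 hνW0 hνf0 hν₂0 hθS hθΘ hθf hθ₂ sgE cc eE tT Te D₀ hrate hsE0 hcc0 heE0 htT0 hTe0 hgdata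

end Summit.HubbardSuperconductivity.HubbardSuperconductivity.Theorems.TwoVolumeSource

end
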